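import Mathlib
import Literature.LinearAlgebra.Matrix.PermanentSubperm
import Summits.ValiantsHypothesis.ValiantsHypothesis.Theorems.ValuativeGCTValuativeFlipCyclicContinuant

/-!
# Arcs of `ZMod n` and the cyclic tridiagonal matrix (crux `ValuativeGCT.ValuativeFlip`, stub `stub_fourRowPencilRank`)

P1 (first half) of the cyclic-tridiagonal architecture for hypothesis `H` of
`fourRowPencilRank_of_pencilCertificate` (`Cruxes/ValuativeFlip/AxisK9G1a2CyclicTridiagonal.md` §2),
over any commutative ring `R`, `n ≥ 3`, sequences `l m m' : ZMod n → R`, for the cyclic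
tridiagonal matrix `cycM` (`A r r = l r`, `A r (r+1) = m r`, `A r (r-1) = m' r`, zero elsewhere),
in the language of `Matrix.subperm` (columns-predicate, rows-predicate):

* `inArc a L` — the arc `a, …, a+L-1`; bookkeeping `inArc_iff`, `inArc_succ_and_ne_last/first`
  (dropping the last / first vertex), `ne_iff_inArc` (`{v ≠ j} = arc(j+1, n-1)`);
* `subperm_cycM_expand` — expansion of a subpermanent of `cycM` along a row: only the columns
  `r-1, r, r+1` contribute (`Matrix.subperm_expand_row_support`);
* `subperm_arc_eq_kont` — **the block on a proper arc (`L ≤ n-1`) has (sub)permanent the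
  continuant `kont l m m' a L`** (expand along the last row; one dead column).
The path minors and the cofactor formula `F = T + S` are file `…CyclicCofactor`.
[this crux; classical combinatorics]
-/

set_option linter.dupNamespace false

namespace Summit.ValiantsHypothesis.ValiantsHypothesis.Theorems.ValuativeFlip

open scoped BigOperators

section arcs

variable {n : ℕ}

/-- Membership in the arc `a, a+1, …, a+L-1` of `ZMod n`. [this crux] -/
def inArc (a : ZMod n) (L : ℕ) (v : ZMod n) : Prop := (v - a).val < L

/-- Membership in an arc is decidable (a comparison of naturals). [this crux] -/
instance inArc.decidable (a : ZMod n) (L : ℕ) : DecidablePred (inArc a L) :=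
  fun _ => Nat.decLt _ _

/-- Casting naturals below `n` into `ZMod n` is injective. [folklore] -/
theorem natCast_zmod_inj {s t : ℕ} (hs : s < n) (ht : t < n) (h : (s : ZMod n) = (t : ZMod n)) :
    s = t := by
  have := congrArg ZMod.val h
  rwa [ZMod.val_cast_of_lt hs, ZMod.val_cast_of_lt ht] at this

/-- A natural `0 < s < n` is nonzero in `ZMod n`. [folklore] -/
theorem natCast_zmod_ne_zero {s : ℕ} (hs0 : 0 < s) (hs : s < n) : (s : ZMod n) ≠ 0 := by
  intro h
  rw [ZMod.natCast_eq_zero_iff] at h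
  exact absurd (Nat.le_of_dvd hs0 h) (by omega)

/-- The vertex just after an arc of length `L < n` is not in it. [this crux] -/
theorem not_inArc_add_self {a : ZMod n} {L : ℕ} (hL : L < n) : ¬ inArc a L (a + (L : ZMod n)) := by
  unfold inArc
  rw [add_sub_cancel_left, ZMod.val_cast_of_lt hL]
  exact lt_irrefl L

/-- The vertex just before an arc of length at most `n - 1` is not in it. [this crux] -/
theorem not_inArc_sub_one {a : ZMod n} {L : ℕ} (hL : L + 1 ≤ n) : ¬ inArc a L (a - 1) := by
  unfold inArc
  have h : a - 1 - a = ((n - 1 : ℕ) : ZMod n) := by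
    rw [Nat.cast_sub (by omega), ZMod.natCast_self, Nat.cast_one]; ring
  rw [h, ZMod.val_cast_of_lt (by omega)]
  omega

variable [NeZero n]

/-- `v ∈ arc(a, L)` iff `v = a + s` with `s < L` (for `L ≤ n`). [this crux] -/
theorem inArc_iff {a : ZMod n} {L : ℕ} (hL : L ≤ n) (v : ZMod n) :
    inArc a L v ↔ ∃ s : ℕ, s < L ∧ v = a + (s : ZMod n) := by
  unfold inArc
  constructor
  · intro h
    exact ⟨(v - a).val, h, by rw [ZMod.natCast_zmod_val]; ring⟩
  · rintro ⟨s, hs, rfl⟩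
    rw [add_sub_cancel_left, ZMod.val_cast_of_lt (by omega)]
    exact hs

/-- `a + s` lies in `arc(a, L)` for `s < L` and `L` at most `n`. [this crux] -/
theorem inArc_add {a : ZMod n} {L s : ℕ} (hs : s < L) (hL : L ≤ n) : inArc a L (a + (s : ZMod n)) :=
  (inArc_iff hL _).2 ⟨s, hs, rfl⟩

/-- `a` lies in `arc(a, L)` for `0 < L` and `L` at most `n`. [this crux] -/
theorem inArc_self {a : ZMod n} {L : ℕ} (hL0 : 0 < L) (hL : L ≤ n) : inArc a L a := by
  simpa using inArc_add (a := a) (s := 0) hL0 hL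

/-- Dropping the last vertex: `arc(a,L+1) ∖ {a+L} = arc(a,L)`. [this crux] -/
theorem inArc_succ_and_ne_last {a : ZMod n} {L : ℕ} (hL : L + 1 ≤ n) (v : ZMod n) :
    (inArc a (L + 1) v ∧ v ≠ a + (L : ZMod n)) ↔ inArc a L v := by
  rw [inArc_iff hL, inArc_iff (by omega)]
  constructor
  · rintro ⟨⟨s, hs, rfl⟩, hne⟩
    refine ⟨s, ?_, rfl⟩
    rcases Nat.lt_succ_iff_lt_or_eq.1 hs with h | h
    · exact h
    · exact absurd (by rw [h]) hne
  · rintro ⟨s, hs, rfl⟩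
    refine ⟨⟨s, by omega, rfl⟩, fun h => ?_⟩
    have := natCast_zmod_inj (by omega) (by omega) (add_left_cancel h)
    omega

/-- Dropping the first vertex: `arc(a,L+1) ∖ {a} = arc(a+1,L)`. [this crux] -/
theorem inArc_succ_and_ne_first {a : ZMod n} {L : ℕ} (hL : L + 1 ≤ n) (v : ZMod n) :
    (inArc a (L + 1) v ∧ v ≠ a) ↔ inArc (a + 1) L v := by
  rw [inArc_iff hL, inArc_iff (by omega)]
  constructor
  · rintro ⟨⟨s, hs, rfl⟩, hne⟩
    have hs0 : s ≠ 0 := by rintro rfl; exact hne (by simp)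
    refine ⟨s - 1, by omega, ?_⟩
    rw [Nat.cast_sub (by omega), Nat.cast_one]; ring
  · rintro ⟨s, hs, rfl⟩
    refine ⟨⟨s + 1, by omega, by push_cast; ring⟩, fun h => ?_⟩
    have h' : ((s + 1 : ℕ) : ZMod n) = 0 := by
      push_cast
      linear_combination h
    exact natCast_zmod_ne_zero (Nat.succ_pos s) (by omega) h'

/-- The complement of a vertex is the arc starting just after it: `{v ≠ j} = arc(j+1, n-1)`.
[this crux] -/
theorem ne_iff_inArc (j v : ZMod n) : v ≠ j ↔ inArc (j + 1) (n - 1) v := by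
  have hn : 0 < n := Nat.pos_of_ne_zero (NeZero.ne n)
  rw [inArc_iff (Nat.sub_le n 1)]
  constructor
  · intro hv
    refine ⟨(v - (j + 1)).val, ?_, by rw [ZMod.natCast_zmod_val]; ring⟩
    have hlt := ZMod.val_lt (v - (j + 1))
    rcases Nat.lt_or_ge (v - (j + 1)).val (n - 1) with h | h
    · exact h
    · exfalso
      apply hv
      have hval : (v - (j + 1)).val = n - 1 := by omega
      have : v - (j + 1) = ((n - 1 : ℕ) : ZMod n) := by
        rw [← hval, ZMod.natCast_zmod_val]
      rw [Nat.cast_sub (by omega), ZMod.natCast_self, Nat.cast_one] at this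
      linear_combination this
  · rintro ⟨s, hs, rfl⟩ h
    have h' : ((s + 1 : ℕ) : ZMod n) = 0 := by push_cast; linear_combination h
    exact natCast_zmod_ne_zero (Nat.succ_pos s) (by omega) h'

end arcs

section matrix

variable {R : Type*} [CommRing R] {n : ℕ}

/-- The cyclic tridiagonal matrix `A r r = l r`, `A r (r+1) = m r`, `A r (r-1) = m' r`.
[this crux] -/
def cycM (l m m' : ZMod n → R) : Matrix (ZMod n) (ZMod n) R :=
  Matrix.of fun r c => if c = r then l r else if c = r + 1 then m r else if c = r - 1 then m' r else 0

variable (l m m' : ZMod n → R)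

/-- Diagonal entries of `cycM` are the loops `l r`. [this crux] -/
theorem cycM_diag (r : ZMod n) : cycM l m m' r r = l r := by simp [cycM]

/-- Entries of `cycM` off the three cyclic diagonals vanish. [this crux] -/
theorem cycM_eq_zero {r c : ZMod n} (h0 : c ≠ r) (h1 : c ≠ r + 1) (h2 : c ≠ r - 1) :
    cycM l m m' r c = 0 := by
  simp only [cycM, Matrix.of_apply, if_neg h0, if_neg h1, if_neg h2]

/-- `1` is nonzero in `ZMod n` for `n` at least `2`. [folklore] -/
theorem one_ne_zero_zmod (hn : 2 ≤ n) : (1 : ZMod n) ≠ 0 := by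
  simpa using natCast_zmod_ne_zero (n := n) (s := 1) Nat.one_pos (by omega)

/-- `2` is nonzero in `ZMod n` for `n` at least `3`. [folklore] -/
theorem two_ne_zero_zmod (hn : 3 ≤ n) : (2 : ZMod n) ≠ 0 := by
  simpa using natCast_zmod_ne_zero (n := n) (s := 2) (by norm_num) (by omega)

/-- Superdiagonal entries of `cycM` are the clockwise forms `m r`. [this crux] -/
theorem cycM_succ (hn : 2 ≤ n) (r : ZMod n) : cycM l m m' r (r + 1) = m r := by
  have h1 := one_ne_zero_zmod (n := n) hn
  have hne : r + 1 ≠ r := by intro h; apply h1; linear_combination h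
  simp [cycM, hne]

/-- Subdiagonal entries of `cycM` are the counter-clockwise forms. [this crux] -/
theorem cycM_pred (hn : 3 ≤ n) (r : ZMod n) : cycM l m m' r (r - 1) = m' r := by
  have h1 := one_ne_zero_zmod (n := n) (by omega)
  have h2 := two_ne_zero_zmod (n := n) hn
  have hne1 : r - 1 ≠ r := by intro h; apply h1; linear_combination -h
  have hne2 : r - 1 ≠ r + 1 := by intro h; apply h2; linear_combination -h
  simp [cycM, hne1, hne2]

variable [NeZero n]

/-- **Expansion of a subpermanent of `cycM` along the row `r`**: only the columns `r-1, r, r+1`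
contribute. [this crux] -/
theorem subperm_cycM_expand (hn : 3 ≤ n) {p q : ZMod n → Prop} [DecidablePred p]
    [DecidablePred q] (r : ZMod n) (hr : q r) :
    (cycM l m m').subperm p q =
      (if p (r - 1) then m' r * (cycM l m m').subperm (fun c => p c ∧ c ≠ r - 1)
        (fun j => q j ∧ j ≠ r) else 0) +
      (if p r then l r * (cycM l m m').subperm (fun c => p c ∧ c ≠ r)
        (fun j => q j ∧ j ≠ r) else 0) +
      (if p (r + 1) then m r * (cycM l m m').subperm (fun c => p c ∧ c ≠ r + 1)
        (fun j => q j ∧ j ≠ r) else 0) := by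
  have h1 := one_ne_zero_zmod (n := n) (by omega)
  have h2 := two_ne_zero_zmod (n := n) hn
  have hne1 : r - 1 ≠ r := by intro h; apply h1; linear_combination -h
  have hne2 : r - 1 ≠ r + 1 := by intro h; apply h2; linear_combination -h
  have hne3 : r ≠ r + 1 := by intro h; apply h1; linear_combination -h
  rw [(cycM l m m').subperm_expand_row_support r hr {r - 1, r, r + 1} (fun i _ hi => ?_)]
  · rw [Finset.sum_filter, Finset.sum_insert (by simp [hne1, hne2]),
      Finset.sum_insert (by simp [hne3]), Finset.sum_singleton,
      cycM_pred l m m' hn, cycM_diag, cycM_succ l m m' (by omega)]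
    exact (add_assoc _ _ _).symm
  · apply cycM_eq_zero
    · intro h; apply hi; simp [h]
    · intro h; apply hi; simp [h]
    · intro h; apply hi; simp [h]

/-- **The block on a proper arc is the continuant**: for `L ≤ n - 1`,
`subperm (arc a L) (arc a L) = K(a, L)`. [this crux] -/
theorem subperm_arc_eq_kont (hn : 3 ≤ n) :
    ∀ (L : ℕ), L + 1 ≤ n → ∀ a : ZMod n,
      (cycM l m m').subperm (inArc a L) (inArc a L) = kont l m m' a L := by
  intro L
  induction L using Nat.twoStepInduction with
  | zero =>
    intro _ a
    rw [kont_zero]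
    exact (cycM l m m').subperm_of_isEmpty (fun v h => Nat.not_lt_zero _ h)
      (fun v h => Nat.not_lt_zero _ h)
  | one =>
    intro hL a
    rw [kont_one, subperm_cycM_expand l m m' hn a (inArc_self Nat.one_pos (by omega)),
      if_neg (not_inArc_sub_one (by omega)), if_pos (inArc_self Nat.one_pos (by omega)),
      if_neg (by simpa using not_inArc_add_self (a := a) (L := 1) (by omega))]
    rw [(cycM l m m').subperm_of_isEmpty, mul_one, zero_add, add_zero]
    · rintro v ⟨hv, hne⟩
      rw [inArc_iff (by omega)] at hv
      obtain ⟨s, hs, rfl⟩ := hv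
      apply hne; have : s = 0 := by omega
      simp [this]
    · rintro v ⟨hv, hne⟩
      rw [inArc_iff (by omega)] at hv
      obtain ⟨s, hs, rfl⟩ := hv
      apply hne; have : s = 0 := by omega
      simp [this]
  | more L ih1 ih2 =>
    intro hL a
    -- expand along the last row `a + (L+1)`
    have hlast : inArc a (L + 2) (a + ((L + 1 : ℕ) : ZMod n)) := inArc_add (by omega) (by omega)
    rw [subperm_cycM_expand l m m' hn _ hlast]
    -- column `a + L + 2` is outside the arc
    have hout : ¬ inArc a (L + 2) (a + ((L + 1 : ℕ) : ZMod n) + 1) := by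
      have := not_inArc_add_self (a := a) (L := L + 2) (by omega)
      convert this using 2
      push_cast; ring
    rw [if_neg hout]
    -- column `a + L + 1` (diagonal): the block on `arc a (L+1)`
    rw [if_pos hlast]
    have hdiag : (cycM l m m').subperm (fun c => inArc a (L + 2) c ∧ c ≠ a + ((L + 1 : ℕ) : ZMod n))
        (fun j => inArc a (L + 2) j ∧ j ≠ a + ((L + 1 : ℕ) : ZMod n)) = kont l m m' a (L + 1) := by
      rw [(cycM l m m').subperm_congr (inArc_succ_and_ne_last (by omega))
        (inArc_succ_and_ne_last (by omega))]
      exact ih2 (by omega) a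
    rw [hdiag]
    -- column `a + L` (entry `m'`): expand along row `a + L`
    have hcol : a + ((L + 1 : ℕ) : ZMod n) - 1 = a + (L : ZMod n) := by push_cast; ring
    rw [hcol, if_pos (inArc_add (by omega) (by omega))]
    have hrow : inArc a (L + 2) (a + (L : ZMod n)) ∧ a + (L : ZMod n) ≠ a + ((L + 1 : ℕ) : ZMod n) := by
      refine ⟨inArc_add (by omega) (by omega), fun h => ?_⟩
      have := natCast_zmod_inj (n := n) (by omega) (by omega) (add_left_cancel h)
      omega
    rw [subperm_cycM_expand l m m' hn (a + (L : ZMod n)) hrow]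
    -- the three columns of row `a + L`: `a+L-1` (dead column `a+L+1` remains), `a+L` (excluded), `a+L+1`
    have hX : (cycM l m m').subperm
        (fun c => (inArc a (L + 2) c ∧ c ≠ a + (L : ZMod n)) ∧ c ≠ a + (L : ZMod n) + 1)
        (fun j => (inArc a (L + 2) j ∧ j ≠ a + ((L + 1 : ℕ) : ZMod n)) ∧ j ≠ a + (L : ZMod n)) =
        kont l m m' a L := by
      rw [← ih1 (by omega) a]
      refine (cycM l m m').subperm_congr (fun v => ?_) (fun v => ?_)
      · rw [← inArc_succ_and_ne_last (L := L) (by omega), ← inArc_succ_and_ne_last (L := L + 1) (by omega)]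
        push_cast
        constructor
        · rintro ⟨⟨h1, h2⟩, h3⟩; exact ⟨⟨h1, by rwa [add_assoc] at h3⟩, h2⟩
        · rintro ⟨⟨h1, h2⟩, h3⟩; exact ⟨⟨h1, h3⟩, by rwa [add_assoc]⟩
      · rw [← inArc_succ_and_ne_last (L := L) (by omega), ← inArc_succ_and_ne_last (L := L + 1) (by omega)]
    have hdead : (cycM l m m').subperm
        (fun c => (inArc a (L + 2) c ∧ c ≠ a + (L : ZMod n)) ∧ c ≠ a + (L : ZMod n) - 1)
        (fun j => (inArc a (L + 2) j ∧ j ≠ a + ((L + 1 : ℕ) : ZMod n)) ∧ j ≠ a + (L : ZMod n)) = 0 := by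
      have h1 := one_ne_zero_zmod (n := n) (by omega)
      have h2 := two_ne_zero_zmod (n := n) hn
      refine (cycM l m m').subperm_eq_zero_of_col (a + (L : ZMod n) + 1) ⟨⟨?_, ?_⟩, ?_⟩ ?_
      · have := inArc_add (a := a) (L := L + 2) (s := L + 1) (by omega) (by omega)
        push_cast at this; rwa [add_assoc]
      · intro h; apply h1; linear_combination h
      · intro h; apply h2; linear_combination h
      · rintro j ⟨⟨hj, hj1⟩, hj2⟩
        apply cycM_eq_zero
        · intro h; apply hj1; rw [← h]; push_cast; ring
        · intro h; apply hj2; linear_combination -h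
        · intro h
          apply not_inArc_add_self (a := a) (L := L + 2) (by omega)
          convert hj using 2
          push_cast; linear_combination h
    rw [hX, hdead, if_neg (show ¬ (inArc a (L + 2) (a + (L : ZMod n)) ∧ a + (L : ZMod n) ≠ a + (L : ZMod n))
      from fun h => h.2 rfl)]
    simp only [mul_zero]
    rw [kont_add_two]
    -- tidy the remaining `if`s
    by_cases hp : (inArc a (L + 2) (a + (L : ZMod n) - 1) ∧ a + (L : ZMod n) - 1 ≠ a + (L : ZMod n))
    · rw [if_pos hp, if_pos]
      · push_cast; ring
      · refine ⟨?_, ?_⟩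
        · have := inArc_add (a := a) (L := L + 2) (s := L + 1) (by omega) (by omega)
          push_cast at this; rwa [add_assoc]
        · intro h
          apply one_ne_zero_zmod (n := n) (by omega)
          linear_combination h
    · rw [if_neg hp, if_pos]
      · push_cast; ring
      · refine ⟨?_, ?_⟩
        · have := inArc_add (a := a) (L := L + 2) (s := L + 1) (by omega) (by omega)
          push_cast at this; rwa [add_assoc]
        · intro h
          apply one_ne_zero_zmod (n := n) (by omega)
          linear_combination h


end matrix

end Summit.ValiantsHypothesis.ValiantsHypothesis.Theorems.ValuativeFlip
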